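import Mathlib.Analysis.InnerProductSpace.PiL2
import Mathlib.Analysis.InnerProductSpace.Calculus
import Mathlib.Analysis.SpecialFunctions.SmoothTransition
import Mathlib.Analysis.Calculus.Deriv.Slope
import Mathlib.Topology.MetricSpace.Pseudo.Lemmas
import HarnessLib

/-!
# Crux `BlockLipschitzL` (stmt-QuantumFields-23533) ∕ `HistoryTailL` (stmt-QuantumFields-19936), LINE 25 «CompactnessTransfer»,
# S1″ row (M) «monotonicity» — LETTERS «THE SMOOTH RADIAL CUTOFF AND THE RADIAL TEST FUNCTIONS»

Cell `ym3-torus` (YM ladder rung R3 = continuum SU(2) Yang–Mills on T³ — a RUNG, NOT the Clay problem: not d = 4, not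
infinite volume, not a mass gap); WIDTH helper seat `ym-ust-19936-w3` g15, for the (M)-PROOF lane of seat w2 g13 (split (δ) = (δ1)
«radial identity» w2 ∕ (δ2) «monotonicity from the radial inequality» w3).  Helper `--supports stmt-QuantumFields-23533`; THEOREMS
ONLY (0 `def`, 0 `sorry`, default heartbeats); Mathlib only.

WHAT IS PROVED (ns `…Theorems.PoincareLipschitzRadialCutoffLetters`).
* §1 the cutoff `g_κ(s) := Real.smoothTransition ((1 − s)∕κ)`: `cutoff_contDiff`, `cutoff_antitone` (`κ > 0`), `cutoff_eq_one`
  (`s ≤ 1 − κ`), `cutoff_eq_zero` (`1 ≤ s`), `cutoff_mem_Icc` (`0 ≤ g_κ ≤ 1`), `cutoff_deriv_nonpos`, `cutoff_deriv_continuous`,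
  `cutoff_deriv_eq_zero` (`1 < s`).
* §2 for ANY differentiable profile `g : ℝ → ℝ`, centre `y`, scale `τ`: ★`hasFDerivAt_radial`
  (`D[x ↦ g(‖x−y‖²∕τ²)] = (g′(‖x−y‖²∕τ²)·(τ²)⁻¹·2) • innerSL ℝ (x − y)`), ★`fderiv_testFun_apply_single` (the gradient of the
  radial test function `f_k(x) = g(‖x−y‖²∕τ²)·(x_k − y_k)` on the coordinate vectors:
  `2·(g′·(τ²)⁻¹)·(xᵢ − yᵢ)·(x_k − y_k) + g·δ_{ki}`), `contDiff_testFun`, `tsupport_testFun_subset` (`⊆ closedBall y τ` when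
  `g = 0` on `[1, ∞)`, `τ > 0`) — the inner-variation fields `ζ = θ(x)(x − y)` of the monotonicity formula [Simon1996, §2.4]
  written per axis.
HONEST SCOPE.  Letters; (M), S1″, `BlockLipschitzL`, `HistoryTailL` are NOT proved here.  YM₃ on T³ is rung R3, not Clay; YM gap NOT
proved; no summit statement is proved here.

References: L. Simon, Theorems on Regularity and Singularity of Energy Minimizing Maps (1996) [Simon1996] (§2.2 (v), §2.4).
-/

set_option autoImplicit false


noncomputable section

open scoped BigOperators Topology RealInnerProductSpace ContDiff
open Set Filter Metric

namespace Summit.QuantumFields.YangMills.Theorems.PoincareLipschitzRadialCutoffLetters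

/-! ## §1 The smooth radial cutoff `g_κ(s) = smoothTransition((1 − s)∕κ)` -/

/-- `g_κ` is smooth. [folklore] -/
theorem cutoff_contDiff (κ : ℝ) {n : ℕ∞} : ContDiff ℝ n (fun s : ℝ => Real.smoothTransition ((1 - s) / κ)) :=
  Real.smoothTransition.contDiff.comp ((contDiff_const.sub contDiff_id).div_const κ)

/-- `g_κ` is non-increasing for `κ > 0`. [folklore] -/
theorem cutoff_antitone {κ : ℝ} (hκ : 0 < κ) : Antitone (fun s : ℝ => Real.smoothTransition ((1 - s) / κ)) :=
  fun a b hab => Real.smoothTransition.monotone (div_le_div_of_nonneg_right (by linarith) hκ.le)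

/-- `g_κ = 1` on `s ≤ 1 − κ` (`κ > 0`). [folklore] -/
theorem cutoff_eq_one {κ s : ℝ} (hκ : 0 < κ) (hs : s ≤ 1 - κ) : Real.smoothTransition ((1 - s) / κ) = 1 :=
  Real.smoothTransition.one_of_one_le (by rw [le_div_iff₀ hκ]; linarith)

/-- `g_κ = 0` on `1 ≤ s`. [folklore] -/
theorem cutoff_eq_zero {κ s : ℝ} (hκ : 0 < κ) (hs : 1 ≤ s) : Real.smoothTransition ((1 - s) / κ) = 0 :=
  Real.smoothTransition.zero_of_nonpos (div_nonpos_of_nonpos_of_nonneg (by linarith) hκ.le)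

/-- `0 ≤ g_κ ≤ 1`. [folklore] -/
theorem cutoff_mem_Icc (κ s : ℝ) : Real.smoothTransition ((1 - s) / κ) ∈ Icc (0 : ℝ) 1 :=
  ⟨Real.smoothTransition.nonneg _, Real.smoothTransition.le_one _⟩

/-- `g_κ' ≤ 0` (`κ > 0`). [folklore] -/
theorem cutoff_deriv_nonpos {κ : ℝ} (hκ : 0 < κ) (s : ℝ) :
    deriv (fun s : ℝ => Real.smoothTransition ((1 - s) / κ)) s ≤ 0 :=
  (cutoff_antitone hκ).deriv_nonpos

/-- `g_κ'` is continuous. [folklore] -/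
theorem cutoff_deriv_continuous (κ : ℝ) : Continuous (deriv (fun s : ℝ => Real.smoothTransition ((1 - s) / κ))) :=
  ((cutoff_contDiff κ (n := 1)).continuous_deriv le_rfl)

/-- `g_κ' = 0` on `1 < s` (`g_κ` vanishes on the open half-line). [folklore] -/
theorem cutoff_deriv_eq_zero {κ s : ℝ} (hκ : 0 < κ) (hs : 1 < s) :
    deriv (fun s : ℝ => Real.smoothTransition ((1 - s) / κ)) s = 0 := by
  have h : (fun s : ℝ => Real.smoothTransition ((1 - s) / κ)) =ᶠ[𝓝 s] fun _ => (0 : ℝ) := by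
    filter_upwards [Ioi_mem_nhds hs] with t ht
    exact cutoff_eq_zero hκ (le_of_lt ht)
  rw [h.deriv_eq]; simp

/-! ## §2 The radial test functions `f_k(x) = g(‖x − y‖²∕τ²)·(x_k − y_k)` and their gradients -/

/-- Gradient of a radial profile: `D[x ↦ g(‖x−y‖²∕τ²)] = g′(‖x−y‖²∕τ²)·τ⁻²·2⟪x − y, ·⟫`. [folklore] -/
theorem hasFDerivAt_radial {g : ℝ → ℝ} (hg : Differentiable ℝ g) (y : EuclideanSpace ℝ (Fin 3)) (τ : ℝ)
    (x : EuclideanSpace ℝ (Fin 3)) :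
    HasFDerivAt (fun x : EuclideanSpace ℝ (Fin 3) => g (‖x - y‖ ^ 2 / τ ^ 2))
      ((deriv g (‖x - y‖ ^ 2 / τ ^ 2) * (τ ^ 2)⁻¹ * 2) • innerSL ℝ (x - y)) x := by
  have h1 : HasFDerivAt (fun x : EuclideanSpace ℝ (Fin 3) => ‖x - y‖ ^ 2)
      ((2 : ℕ) • innerSL ℝ (x - y)) x := by
    have := ((hasFDerivAt_id x).sub_const y).norm_sq
    simpa only [id_eq, ContinuousLinearMap.comp_id] using this
  have h2 : HasFDerivAt (fun x : EuclideanSpace ℝ (Fin 3) => ‖x - y‖ ^ 2 / τ ^ 2)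
      ((τ ^ 2)⁻¹ • ((2 : ℕ) • innerSL ℝ (x - y))) x := by
    have := h1.mul_const (τ ^ 2)⁻¹
    simpa only [div_eq_mul_inv] using this
  have h3 := ((hg (‖x - y‖ ^ 2 / τ ^ 2)).hasDerivAt).comp_hasFDerivAt x h2
  refine h3.congr_fderiv ?_
  ext v
  simp only [smul_apply, smul_eq_mul, nsmul_eq_mul, Nat.cast_ofNat]
  ring

/-- Gradient of the radial test function `f_k`: `∂ᵢ f_k = 2c·dᵢ·d_k + θ·δ_{ik}`, `d = x − y`, `θ = g(‖d‖²∕τ²)`,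
`c = g′(‖d‖²∕τ²)·τ⁻²`. [folklore] -/
theorem fderiv_testFun_apply_single {g : ℝ → ℝ} (hg : Differentiable ℝ g) (y : EuclideanSpace ℝ (Fin 3)) (τ : ℝ)
    (k i : Fin 3) (x : EuclideanSpace ℝ (Fin 3)) :
    fderiv ℝ (fun x : EuclideanSpace ℝ (Fin 3) => g (‖x - y‖ ^ 2 / τ ^ 2) * (x k - y k)) x (EuclideanSpace.single i (1:ℝ)) =
      2 * (deriv g (‖x - y‖ ^ 2 / τ ^ 2) * (τ ^ 2)⁻¹) * (x i - y i) * (x k - y k) +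
        g (‖x - y‖ ^ 2 / τ ^ 2) * (if k = i then 1 else 0) := by
  have hθ := hasFDerivAt_radial hg y τ x
  have hℓ : HasFDerivAt (fun x : EuclideanSpace ℝ (Fin 3) => x k - y k) (PiLp.proj (𝕜 := ℝ) 2 (fun _ : Fin 3 => ℝ) k) x := by
    have := ((PiLp.proj (𝕜 := ℝ) 2 (fun _ : Fin 3 => ℝ) k).hasFDerivAt (x := x)).sub_const (y k)
    simpa only [PiLp.proj_apply] using this
  have hprod : HasFDerivAt (fun x : EuclideanSpace ℝ (Fin 3) => g (‖x - y‖ ^ 2 / τ ^ 2) * (x k - y k))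
      (g (‖x - y‖ ^ 2 / τ ^ 2) • PiLp.proj (𝕜 := ℝ) 2 (fun _ : Fin 3 => ℝ) k +
        (x k - y k) • ((deriv g (‖x - y‖ ^ 2 / τ ^ 2) * (τ ^ 2)⁻¹ * 2) • innerSL ℝ (x - y))) x := hθ.mul hℓ
  rw [hprod.fderiv]
  simp only [add_apply, smul_apply, smul_eq_mul, innerSL_apply_apply,
    EuclideanSpace.inner_single_right, one_mul, PiLp.proj_apply, PiLp.sub_apply]
  have hs : (EuclideanSpace.single i (1:ℝ)) k = if k = i then 1 else 0 := by
    simp [PiLp.single_apply]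
  rw [hs]
  simp only [conj_trivial]
  ring

/-- The radial test function is smooth when the profile is. [folklore] -/
theorem contDiff_testFun {g : ℝ → ℝ} {n : ℕ∞} (hg : ContDiff ℝ n g) (y : EuclideanSpace ℝ (Fin 3)) (τ : ℝ) (k : Fin 3) :
    ContDiff ℝ n (fun x : EuclideanSpace ℝ (Fin 3) => g (‖x - y‖ ^ 2 / τ ^ 2) * (x k - y k)) :=
  (hg.comp (((contDiff_id.sub contDiff_const).norm_sq ℝ).div_const _)).mul
    ((EuclideanSpace.proj (𝕜 := ℝ) k).contDiff.sub contDiff_const)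

/-- Support of the radial test function: inside `B̄(y, τ)` when `g = 0` on `[1, ∞)` and `τ > 0`. [folklore] -/
theorem tsupport_testFun_subset {g : ℝ → ℝ} (hg0 : ∀ s : ℝ, 1 ≤ s → g s = 0) (y : EuclideanSpace ℝ (Fin 3)) {τ : ℝ}
    (hτ : 0 < τ) (k : Fin 3) :
    tsupport (fun x : EuclideanSpace ℝ (Fin 3) => g (‖x - y‖ ^ 2 / τ ^ 2) * (x k - y k)) ⊆ closedBall y τ := by
  refine closure_minimal ?_ isClosed_closedBall
  intro x hx
  rw [mem_closedBall, dist_eq_norm]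
  by_contra h
  push Not at h
  have h1 : 1 ≤ ‖x - y‖ ^ 2 / τ ^ 2 := by
    rw [le_div_iff₀ (by positivity), one_mul]
    exact pow_le_pow_left₀ hτ.le h.le 2
  exact hx (by simp [hg0 _ h1])

end Summit.QuantumFields.YangMills.Theorems.PoincareLipschitzRadialCutoffLetters

end
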